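import Mathlib
import HarnessLib
import Summits.AtomisticToContinuum.HydrodynamicLimit.Theses.OneFlightGossipEngine
import Literature.Analysis.FluidPDE.HardSphereCollisionRecord

/-!
# One-snapshot variant of `OneFlightLayeredChaos` (crux stmt-AtomisticToContinuum-14535) — typed, for the planner

Lead's appendix to `NOTES.md` (this crux dir), §B5/§C. The typed crux conditions on `coarsePastOf` = the coarse
configurations (cells + EXACT velocities of all particles) at BOTH flight starts `s_i`, `s_j` of the `n`-th
collision of `i`. The repair menus of PINNING-14535 (R2) / TwoSnapshotRigidity (R1) propose ONE snapshot at the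
LATER flight start `s₊ = max s_i s_j` (both `i` and its partner are then on their final free flights; no second
exact-velocity snapshot, hence no inter-snapshot constraint system — neither the local rigidity of BN1/BN2 nor the
branch-equidistribution stub of the lead's NOTES §B4 arises). This file only TYPES that variant over the existing
vocabulary (no new definition; `flightStart`, `nthCollisionTimeOf`, `nthPartnerOf`, `coarseConfig` are in
`HardSphereCollisionRecord.lean`) so that a restatement, if the planner wants it, is copy-ready and known to
elaborate. It is NOT a claim that the typed crux is false (it is not refuted: lead NOTES §B), and it is weaker than the
crux only in the conditioning σ-algebra (same frame, quantifier order, window, rate).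
-/

namespace Summit.AtomisticToContinuum.HydrodynamicLimit.Cruxes.OneFlightLayeredChaos.Lead

open MeasureTheory
open Literature.Analysis.FluidPDE Literature.MathematicalPhysics.KineticTheory

/-- The later of the two flight starts of the `n`-th collision of `i` along the orbit of `z`:
`max (flightStart of i) (flightStart of its n-th partner)` before the `n`-th collision time (from time `0`).
[folklore] -/
noncomputable def laterFlightStart {N : ℕ} {ε : ℝ}
    (Φ : HardSphereFlow (Torus.geometry (Fin 3)) ε N) (i : Fin N) (n : ℕ) (z : Config N (Fin 3) T3) : ℝ :=
  max (flightStart (Torus.geometry (Fin 3)) ε (fun t => Φ.flow t z) 0 i (Φ.nthCollisionTimeOf i n z))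
    (flightStart (Torus.geometry (Fin 3)) ε (fun t => Φ.flow t z) 0 (Φ.nthPartnerOf i n z)
      (Φ.nthCollisionTimeOf i n z))

/-- **One-snapshot layered chaos** (variant R-one-snapshot of crux 14535): the crux `OneFlightLayeredChaos`
verbatim, except that the conditioning σ-algebra is generated by the coarse configuration (r_N-cells of all
positions + exact velocities of all particles) at the LATER flight start `s₊` only, and the partner's identity.
[folklore] -/
def OneSnapshotLayeredChaos : Prop :=
  ∀ (a₀ θ₀ : ℝ), 0 < a₀ → 0 < θ₀ → ∃ C : ℝ, 0 < C ∧ ∃ p : ℝ, 0 < p ∧ ∃ σ₀ : ℝ, 0 < σ₀ ∧ ∀ σ : ℝ, 0 < σ → σ < σ₀ → ∃ ρ : ℝ, σ ≤ ρ ∧ ρ * (Real.sqrt 2 * Real.pi * σ ^ 2) ≤ 1 ∧ ∀ τ : ℝ, 0 < τ → ∀ n : ℕ, ∃ N₀ : ℕ, ∀ N : ℕ, N₀ ≤ N → ∀ Φ : Literature.Analysis.FluidPDE.HardSphereFlow (Literature.Analysis.FluidPDE.Torus.geometry (Fin 3)) (Literature.MathematicalPhysics.KineticTheory.hsDiameter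 σ N) (N + 1), ∀ (i : Fin (N + 1)) (B : Set Literature.MathematicalPhysics.KineticTheory.V3), MeasurableSet B → let G : Literature.Analysis.FluidPDE.Geometry (Fin 3) Literature.MathematicalPhysics.KineticTheory.T3 := Literature.Analysis.FluidPDE.Torus.geometry (Fin 3); let ε : ℝ := Literature.MathematicalPhysics.KineticTheory.hsDiameter σ N; let w : ℝ := τ * ((N + 1 : ℕ) : ℝ) ^ (-(1 / 3 : ℝ)); let q : Literature.MathematicalPhysics.KineticTheory.T3 → (Fin 3 → ℤ) := Literature.Analysis.FluidPDE.Torus.coarseCell (ρ * ((N + 1 : ℕ) : ℝ) ^ (-(1 / 3 : ℝ))); let P : MeasureTheory.Measure (Literature.Analysis.FluidPDE.Config (N + 1) (Fin 3) Literature.MathematicalPhysics.KineticTheory.T3) := Literature.MathematicalPhysics.KineticTheory.localGibbsLaw σ (fun _ => a₀) (fun _ => 0) (fun _ => θ₀) N Φ; let W : Set (Literature.Analysis.FluidPDE.Config (N + 1) (Fin 3) Literature.MathematicalPhysics.KineticTheory.T3) := {z | n + 1 ≤ Set.ncard (Literature.Analysis.FluidPDE.collisionTimesOf G ε (fun t =>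 Φ.flow t z) i ∩ Set.Ioc 0 w)}; let A : Set (Literature.Analysis.FluidPDE.Config (N + 1) (Fin 3) Literature.MathematicalPhysics.KineticTheory.T3) := {z | (Φ.nthRecordOf i n z).outDir ∈ B}; let u : ℝ := (((Literature.MathematicalPhysics.KineticTheory.sphereMeasure (E := Literature.MathematicalPhysics.KineticTheory.V3)) Set.univ)⁻¹ * (Literature.MathematicalPhysics.KineticTheory.sphereMeasure (E := Literature.MathematicalPhysics.KineticTheory.V3)) {ω | (ω : Literature.MathematicalPhysics.KineticTheory.V3) ∈ B}).toReal; ∀ E : Set (Literature.Analysis.FluidPDE.Config (N + 1) (Fin 3) Literature.MathematicalPhysics.KineticTheory.T3), MeasurableSet[MeasurableSpace.comap (fun z => (Literature.Analysis.FluidPDE.coarseConfig q (Φ.flow (laterFlightStart Φ i n z) z), Φ.nthPartnerOf i n z)) inferInstance] E → |(P (W ∩ A ∩ E)).toReal - u * (P (W ∩ E)).toReal| ≤ C * σ ^ p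

/-- The crux implies the one-snapshot variant is NOT automatic in this typing (the one-snapshot σ-algebra is not
literally a sub-σ-algebra of the two-snapshot one: `max` of the two times is a function of the pair of snapshots
only through the flow). Recorded as the comparison a planner would want; no proof offered here. [folklore] -/
def CruxImpliesOneSnapshot : Prop :=
  Summit.AtomisticToContinuum.HydrodynamicLimit.Theses.OneFlightGossipEngine.OneFlightLayeredChaos →
    OneSnapshotLayeredChaos

end Summit.AtomisticToContinuum.HydrodynamicLimit.Cruxes.OneFlightLayeredChaos.Lead
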